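import Summits.BirchSwinnertonDyer.BirchSwinnertonDyer.Theorems.PrintCf2SplitBadTwoCMPrimaryPinningSwap
import HarnessLib

/-!
# Crux `PrintCf2.SplitBadTwoRankOneOfFacts` (item stmt-BirchSwinnertonDyer-20368), road α over the CM field:
# THE NAMED MODULE `E[𝔮_{ρ'}^∞]` IS AN ORDINARY-FILTRATION DATUM AT `𝔭 ∣ 2` (p640618's two signed clauses, VERBATIM, with `C := E[𝔮_{ρ'}^∞]`)

Cell `bsd-print-cf2`, width seat `bsd-line-cf2-p1-w2` g8; `--supports stmt-BirchSwinnertonDyer-20368` (helper). HONEST FRAMING: nothing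
here closes a crux or a stub; BSD is not proved by any of this; no summit statement is proved by this seat. THEOREMS ONLY (no
definition, no named fact, no `sorry`). FILE 5 of the -w2 g8 pinning series (FILES 1–4: `…CMPrimaryLocalTypesOfDatum`,
`…CMPrimaryLocalPinning`, `…CMPrimaryConjugationTransport`, `…CMPrimaryPinningSwap`).

WHAT. The eisenstein line's local inputs at `2` (p633758 `EisensteinTwo.finLoc_two_of_ordinaryFiltration`, p640618
`stub_ordinaryFiltrationAtTwo`) are phrased with an EXISTENTIAL Greenberg datum `∃ C α, …` on `E_K[2^∞]`: a subgroup `C` and a unit `α`,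
`α² = α − 2`, such that every `σ ∈ Γ_{K_𝔭}` of Frobenius degree `n` acts on `E[2^∞] ⧸ C` as any `N ≡ ±αⁿ` (graded) and on `C[2^k]` as any
`N ≡ ±ε(res σ)·α^{−n}`. Road α's v9.1 stubs speak instead about the NAMED module `E[𝔮_r^∞] = (W.baseChange K).endEigenPrimaryTorsion 2 π r`
(p646843) pinned at `v`. This file identifies the two currencies BY AN EQUALITY OF THE DATUM: for `W/ℚ` with `j = −3375`, `K ∋ θ`, `θ² = −7`,
`𝔭 ∣ 2` with `f(𝔭|2) = 1`, `π² = π − 2`, `r² = r − 2`: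
* `endEigenPrimaryTorsion_two_isOrdinaryFiltrationDatum` — the roots are ordered `(ρ, ρ')` and there is a unit `α`, `α² = α − 2`,
  `α ∈ {r, 1 − r}`, such that `C := E[𝔮_{ρ'}^∞]` satisfies BOTH signed clauses of `stub_ordinaryFiltrationAtTwo` VERBATIM (so every consumer of
  the existential datum — `finLoc_two_of_ordinaryFiltration`, the uniqueness files — can be fed the named module); from FILE 2's local types:
  the quotient clause modulo `E[𝔮_{ρ'}^∞]` follows from the pointwise clause (U) on the complement `E[𝔮_ρ^∞]` by the direct-sum decomposition;
* `endEigenPrimaryTorsion_two_isOrdinaryFiltrationDatum_of_pinned` — if `(π, ρ)` is pinned at `𝔭` (`GreenbergSelmer.inertia 𝔭` acts on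
  `E[𝔮_ρ^∞]` through `{±1}`), the datum is `C := E[𝔮_{1−ρ}^∞]`;
* `endEigenPrimaryTorsion_two_isOrdinaryFiltrationDatum_at_conj` — for `K` imaginary quadratic and `v ≠ v̄` above `2`: if `(π, ρ)` is pinned
  at `v` then AT `v̄` the datum is `C := E[𝔮_ρ^∞]` itself (FILE 4's swap) — «`W[v̄^∞]` is Greenberg's line at `v̄`».
Together with FILE 1's `eq_endEigenPrimaryTorsion_two_of_divisible` (any 2-DIVISIBLE datum equals `E[𝔮_{ρ'}^∞]`) this pins Greenberg's
transported reduction line of `49a1` to the named module. beyond-print theorem: no (Rubin LNM 1716 §3 Lemma 3.6 (ii): `E[𝔭ⁿ] ⊂ E₁`, the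
kernel of reduction, for the inseparable `[πⁿ]`; Greenberg LNM 1716 §2 pp. 62–63: `C_v = ℱ(𝔪̄)[p^∞]`).

References: K. Rubin, LNM 1716 (1999) §3 Lemma 3.6 (ii), Cor. 3.17; R. Greenberg, LNM 1716 (1999) §2 pp. 62–63, 70; [SilvermanAEC2009]
X.5 Cor. 5.4.1.
-/

noncomputable section

open scoped Classical

set_option linter.dupNamespace false
set_option autoImplicit false

namespace Summit.BirchSwinnertonDyer.BirchSwinnertonDyer.Theorems.PrintCf2.CMPrimes

open WeierstrassCurve Literature.NumberTheory.EllipticCurves Literature.NumberTheory.GaloisRepresentations Field NumberField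
  IsDedekindDomain

variable (W : WeierstrassCurve ℚ) [W.IsElliptic] (K : Type) [Field K] [NumberField K]

omit [W.IsElliptic] in
/-- **Quotient clause from the pointwise clause on a complement.** `M₁ ⊓ M₂ = ⊥`, `M₁ ⊔ M₂ = ⊤`, both `g`-stable; if `g` acts on `M₁[2^k]`
as the integer `N`, then `g` acts on `(E[2^∞] ⧸ M₂)[2^k]` as `N` in the graded sense: `2^k x ∈ M₂ ⟹ g x − N x ∈ M₂`. [folklore] -/
theorem smul_sub_zsmul_mem_of_compl {M₁ M₂ : AddSubgroup ((W.baseChange K).geomPrimaryTorsion 2)} (hinf : M₁ ⊓ M₂ = ⊥)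
    (hsup : M₁ ⊔ M₂ = ⊤) (g : absoluteGaloisGroup K) (h₁ : ∀ x ∈ M₁, g • x ∈ M₁) (h₂ : ∀ x ∈ M₂, g • x ∈ M₂) {k : ℕ} {N : ℤ}
    (hN : ∀ y ∈ M₁, 2 ^ k • y = 0 → g • y = N • y) {x : (W.baseChange K).geomPrimaryTorsion 2} (hx : 2 ^ k • x ∈ M₂) :
    g • x - N • x ∈ M₂ := by
  have hx' : x ∈ M₁ ⊔ M₂ := hsup ▸ AddSubgroup.mem_top x
  obtain ⟨y, hy, z, hz, rfl⟩ := AddSubgroup.mem_sup.mp hx'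
  have hyk : 2 ^ k • y = 0 := by
    have hmem : 2 ^ k • y ∈ M₁ ⊓ M₂ := by
      refine ⟨M₁.nsmul_mem hy _, ?_⟩
      have : 2 ^ k • y = 2 ^ k • (y + z) - 2 ^ k • z := by rw [nsmul_add, add_sub_cancel_right]
      rw [this]
      exact M₂.sub_mem hx (M₂.nsmul_mem hz _)
    rw [hinf] at hmem
    exact (AddSubgroup.mem_bot).mp hmem
  have _ := h₁
  rw [smul_add, smul_add, hN y hy hyk, add_sub_add_left_eq_sub]
  exact M₂.sub_mem (h₂ z hz) (M₂.zsmul_mem hz N)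

/-- **THE NAMED MODULE `E[𝔮_{ρ'}^∞]` IS AN ORDINARY-FILTRATION DATUM AT `𝔭` (p640618's two signed clauses VERBATIM).** `W/ℚ` elliptic,
`j = −3375`, `K ∋ θ` with `θ² = −7`, `𝔭 ∣ 2` with `f(𝔭|2) = 1`, `π ∈ End_K(E_K)` with `π² = π − 2`, `r² = r − 2`: the roots are ordered
`(ρ, ρ')` and there is a unit `α`, `α² = α − 2`, `α ∈ {r, 1 − r}`, such that for every `σ ∈ Γ_{K_𝔭}` of Frobenius degree `n` there are
signs `s₁, s₂ = ±1` with (quotient) `2^k x ∈ E[𝔮_{ρ'}^∞] ⟹ res σ • x − N • x ∈ E[𝔮_{ρ'}^∞]` for `N ≡ s₂αⁿ (mod 2^k)` and (line) `res σ` acts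
on `E[𝔮_{ρ'}^∞][2^k]` as any `N ≡ s₁ε(res σ)α^{−n}`. [cite: GreenbergLNM1716, §2 pp. 62–63 and p. 70] [cite: Rubin1999, §3 Lemma 3.6 (ii)] -/
theorem endEigenPrimaryTorsion_two_isOrdinaryFiltrationDatum (hj : W.j = -3375) {θ : K} (hθ : θ ^ 2 = -7)
    (π : (W.baseChange K).endRing) (hrel : (π : AddMonoid.End (W.baseChange K).geomPoints) * π = π - 2)
    {r : ℤ_[2]} (hr : r * r = r - 2) (𝔭 : HeightOneSpectrum (𝓞 K)) (h𝔭 : ((2 : ℕ) : 𝓞 K) ∈ 𝔭.asIdeal)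
    (hf : 𝔭.asIdeal.inertiaDeg (𝓞 ℚ) = 1) :
    ∃ (ρ ρ' : ℤ_[2]) (α : ℤ_[2]ˣ), ((ρ = r ∧ ρ' = 1 - r) ∨ (ρ = 1 - r ∧ ρ' = r)) ∧
      (α : ℤ_[2]) ^ 2 = (α : ℤ_[2]) - 2 ∧ ((α : ℤ_[2]) = r ∨ (α : ℤ_[2]) = 1 - r) ∧
      ∀ (σ : absoluteGaloisGroup (𝔭.adicCompletion K)) (n : ℕ), IsFrobPow σ (n : ℤ) →
        ∃ s₁ s₂ : ℤ, (s₁ = 1 ∨ s₁ = -1) ∧ (s₂ = 1 ∨ s₂ = -1) ∧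
          (∀ (k : ℕ) (x : (W.baseChange K).geomPrimaryTorsion 2),
            2 ^ k • x ∈ (W.baseChange K).endEigenPrimaryTorsion 2 π ρ' →
            ∀ N : ℤ, ((N : ℤ_[2]) - s₂ * ((α ^ n : ℤ_[2]ˣ) : ℤ_[2])) ∈ (Ideal.span {(2 : ℤ_[2]) ^ k} : Ideal ℤ_[2]) →
              absGaloisRestrict K (𝔭.adicCompletion K) σ • x - N • x ∈ (W.baseChange K).endEigenPrimaryTorsion 2 π ρ') ∧
          (∀ (k : ℕ) (c : (W.baseChange K).geomPrimaryTorsion 2), c ∈ (W.baseChange K).endEigenPrimaryTorsion 2 π ρ' →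
            2 ^ k • c = 0 →
            ∀ N : ℤ, ((N : ℤ_[2]) - s₁ *
                ((GaloisRep.cyclotomicCharacter K 2 (absGaloisRestrict K (𝔭.adicCompletion K) σ) * (α⁻¹) ^ n :
                  ℤ_[2]ˣ) : ℤ_[2])) ∈ (Ideal.span {(2 : ℤ_[2]) ^ k} : Ideal ℤ_[2]) →
              absGaloisRestrict K (𝔭.adicCompletion K) σ • c = N • c) := by
  obtain ⟨ρ, ρ', α, hρρ', hα, hαr, hU, hR, -⟩ := endEigenPrimaryTorsion_two_localTypes W K hj hθ π hrel hr 𝔭 h𝔭 hf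
  -- the decomposition `E[𝔮_ρ^∞] ⊕ E[𝔮_{ρ'}^∞] = E[2^∞]`
  obtain ⟨hinf, hsup, -⟩ := endEigenPrimaryTorsion_two_structure W hj K hθ π hrel hr
  have hinf' : (W.baseChange K).endEigenPrimaryTorsion 2 π ρ ⊓ (W.baseChange K).endEigenPrimaryTorsion 2 π ρ' = ⊥ := by
    rcases hρρ' with ⟨rfl, rfl⟩ | ⟨rfl, rfl⟩
    · exact hinf
    · rw [inf_comm]; exact hinf
  have hsup' : (W.baseChange K).endEigenPrimaryTorsion 2 π ρ ⊔ (W.baseChange K).endEigenPrimaryTorsion 2 π ρ' = ⊤ := by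
    rcases hρρ' with ⟨rfl, rfl⟩ | ⟨rfl, rfl⟩
    · exact hsup
    · rw [sup_comm]; exact hsup
  refine ⟨ρ, ρ', α, hρρ', hα, hαr, fun σ n hσ ↦ ?_⟩
  obtain ⟨s₂, hs₂, hUσ⟩ := hU σ n hσ
  obtain ⟨s₁, hs₁, hRσ⟩ := hR σ n hσ
  refine ⟨s₁, s₂, hs₁, hs₂, fun k x hx N hN ↦ ?_, fun k c hc hck N hN ↦ hRσ k c hc hck N hN⟩
  exact smul_sub_zsmul_mem_of_compl W K hinf' hsup' _
    (fun y hy ↦ smul_mem_endEigenPrimaryTorsion π ρ _ hy) (fun y hy ↦ smul_mem_endEigenPrimaryTorsion π ρ' _ hy)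
    (fun y hy hyk ↦ hUσ k y hy hyk N hN) hx

/-- **PINNED VERSION: if `(π, ρ)` is pinned at `𝔭`, the Greenberg datum at `𝔭` is `E[𝔮_{1−ρ}^∞]`.** Same setting; if `GreenbergSelmer.inertia 𝔭`
acts on `E[𝔮_ρ^∞]` pointwise through `{±1}`, then `C := E[𝔮_{1−ρ}^∞]` (with some unit `α`, `α² = α − 2`, `α ∈ {ρ, 1 − ρ}`) satisfies both
signed clauses of p640618 at `𝔭`. [cite: GreenbergLNM1716, §2 pp. 62–63 and p. 70] [cite: Rubin1999, §3 Lemma 3.6 (ii) and Cor. 3.17] -/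
theorem endEigenPrimaryTorsion_two_isOrdinaryFiltrationDatum_of_pinned (hj : W.j = -3375) {θ : K} (hθ : θ ^ 2 = -7)
    (π : (W.baseChange K).endRing) (hrel : (π : AddMonoid.End (W.baseChange K).geomPoints) * π = π - 2)
    {ρ : ℤ_[2]} (hρ : ρ * ρ = ρ - 2) (𝔭 : HeightOneSpectrum (𝓞 K)) (h𝔭 : ((2 : ℕ) : 𝓞 K) ∈ 𝔭.asIdeal)
    (hf : 𝔭.asIdeal.inertiaDeg (𝓞 ℚ) = 1)
    (hclause : ∀ τ ∈ GreenbergSelmer.inertia 𝔭, ∀ x ∈ (W.baseChange K).endEigenPrimaryTorsion 2 π ρ, τ • x = x ∨ τ • x = -x) :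
    ∃ α : ℤ_[2]ˣ, (α : ℤ_[2]) ^ 2 = (α : ℤ_[2]) - 2 ∧ ((α : ℤ_[2]) = ρ ∨ (α : ℤ_[2]) = 1 - ρ) ∧
      ∀ (σ : absoluteGaloisGroup (𝔭.adicCompletion K)) (n : ℕ), IsFrobPow σ (n : ℤ) →
        ∃ s₁ s₂ : ℤ, (s₁ = 1 ∨ s₁ = -1) ∧ (s₂ = 1 ∨ s₂ = -1) ∧
          (∀ (k : ℕ) (x : (W.baseChange K).geomPrimaryTorsion 2),
            2 ^ k • x ∈ (W.baseChange K).endEigenPrimaryTorsion 2 π (1 - ρ) →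
            ∀ N : ℤ, ((N : ℤ_[2]) - s₂ * ((α ^ n : ℤ_[2]ˣ) : ℤ_[2])) ∈ (Ideal.span {(2 : ℤ_[2]) ^ k} : Ideal ℤ_[2]) →
              absGaloisRestrict K (𝔭.adicCompletion K) σ • x - N • x ∈ (W.baseChange K).endEigenPrimaryTorsion 2 π (1 - ρ)) ∧
          (∀ (k : ℕ) (c : (W.baseChange K).geomPrimaryTorsion 2), c ∈ (W.baseChange K).endEigenPrimaryTorsion 2 π (1 - ρ) →
            2 ^ k • c = 0 →
            ∀ N : ℤ, ((N : ℤ_[2]) - s₁ *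
                ((GaloisRep.cyclotomicCharacter K 2 (absGaloisRestrict K (𝔭.adicCompletion K) σ) * (α⁻¹) ^ n :
                  ℤ_[2]ˣ) : ℤ_[2])) ∈ (Ideal.span {(2 : ℤ_[2]) ^ k} : Ideal ℤ_[2]) →
              absGaloisRestrict K (𝔭.adicCompletion K) σ • c = N • c) := by
  obtain ⟨ρ₁, ρ₂, α, hρρ, hα, hαρ, hdat⟩ :=
    endEigenPrimaryTorsion_two_isOrdinaryFiltrationDatum W K hj hθ π hrel hρ 𝔭 h𝔭 hf
  -- the ordering is `(ρ, 1 − ρ)`: otherwise the clause would hold for `E[𝔮_{1−ρ}^∞] = E[𝔮_{ρ₁}^∞]` too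
  obtain ⟨ρ₃, ρ₄, hρρ'', -, τ, hτ, x, hx, hx₁, hx₂⟩ := endEigenPrimaryTorsion_two_inertia_smul W K hj hθ π hrel hρ 𝔭 h𝔭 hf
  -- `ρ₄ ≠ ρ` (the clause fails for `ρ₄`), so `ρ₄ = 1 − ρ`
  have hρ₄ : ρ₄ = 1 - ρ := by
    rcases hρρ'' with ⟨-, h4⟩ | ⟨-, h4⟩
    · exact h4
    · exfalso
      subst h4
      rcases hclause τ hτ x hx with h | h
      · exact hx₁ h
      · exact hx₂ h
  subst hρ₄
  rcases hρρ with ⟨-, h2⟩ | ⟨-, h2⟩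
  · rw [h2] at hdat
    exact ⟨α, hα, hαρ, hdat⟩
  · -- ordering `(1 − ρ, ρ)`: the quotient clause modulo `C = E[𝔮_ρ^∞]` gives the `±1`-clause on `E[𝔮_{1−ρ}^∞]`, absurd
    rw [h2] at hdat
    exfalso
    obtain ⟨σ, hσI, rfl⟩ := Subgroup.mem_map.mp hτ
    obtain ⟨s₁, s₂, -, hs₂, hquot, -⟩ := hdat σ 0 (by exact_mod_cast (isFrobPow_zero_iff_mem_absInertia.mpr hσI))
    simp only [pow_zero, Units.val_one, mul_one] at hquot
    -- `E[𝔮_{1−ρ}^∞] ⊄ E[𝔮_ρ^∞]`-complement argument: the quotient clause modulo `E[𝔮_ρ^∞]` gives the (U)-clause on `E[𝔮_{1−ρ}^∞]`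
    have hr' : (1 - ρ) * (1 - ρ) = (1 - ρ) - 2 := by linear_combination hρ
    obtain ⟨hinf, -, -, h₂, -⟩ := endEigenPrimaryTorsion_two_structure W hj K hθ π hrel hρ
    have hnot : ¬ (W.baseChange K).endEigenPrimaryTorsion 2 π (1 - ρ) ≤ (W.baseChange K).endEigenPrimaryTorsion 2 π ρ := by
      intro hle
      exact h₂ (le_bot_iff.mp (hinf ▸ le_inf hle le_rfl))
    have key := endEigenPrimaryTorsion_two_smul_eq_of_not_le W K hj hθ π hrel hr' hnot _ hquot
    obtain ⟨k, hk⟩ : ∃ k : ℕ, 2 ^ k • x = 0 := by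
      obtain ⟨k, hk⟩ := (AddCommGroup.mem_primaryComponent).mp x.2
      exact ⟨k, Subtype.ext (by rw [AddSubmonoidClass.coe_nsmul, ZeroMemClass.coe_zero]; exact hk)⟩
    have h := key k x hx hk s₂ (by rw [sub_self]; exact Submodule.zero_mem _)
    rcases hs₂ with rfl | rfl
    · exact hx₁ (show absGaloisRestrict K (𝔭.adicCompletion K) σ • x = x by rw [h, one_zsmul])
    · exact hx₂ (show absGaloisRestrict K (𝔭.adicCompletion K) σ • x = -x by rw [h, neg_one_zsmul])

/-- **AT `v̄`, THE MODULE PINNED AT `v` IS ITSELF THE GREENBERG DATUM.** `K` imaginary quadratic with `θ² = −7`, `v ≠ v̄` above `2`; if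
`(π, ρ)` is pinned at `v`, then `C := E[𝔮_ρ^∞]` (with a unit `α`, `α² = α − 2`, `α ∈ {ρ, 1 − ρ}`) satisfies both signed clauses of p640618
at `v̄` — «`W[v̄^∞]` is the kernel-of-reduction line at `v̄`» (FILE 4's swap + the pinned version at `v̄`).
[cite: GreenbergLNM1716, §2 pp. 62–63 and p. 70] [cite: Rubin1999, §3 Lemma 3.6 (ii) and Cor. 3.17] [cite: GrossLMS1991, §5 (5.1)] -/
theorem endEigenPrimaryTorsion_two_isOrdinaryFiltrationDatum_at_conj (hj : W.j = -3375) (hK : IsImaginaryQuadratic K) {θ : K}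
    (hθ : θ ^ 2 = -7) (π : (W.baseChange K).endRing) (hrel : (π : AddMonoid.End (W.baseChange K).geomPoints) * π = π - 2)
    {ρ : ℤ_[2]} (hρ : ρ * ρ = ρ - 2) {v vbar : HeightOneSpectrum (𝓞 K)}
    (hv : ((2 : ℕ) : 𝓞 K) ∈ v.asIdeal) (hvbar : ((2 : ℕ) : 𝓞 K) ∈ vbar.asIdeal) (hne : vbar ≠ v)
    (hclause : ∀ τ ∈ GreenbergSelmer.inertia v, ∀ x ∈ (W.baseChange K).endEigenPrimaryTorsion 2 π ρ, τ • x = x ∨ τ • x = -x) :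
    ∃ α : ℤ_[2]ˣ, (α : ℤ_[2]) ^ 2 = (α : ℤ_[2]) - 2 ∧ ((α : ℤ_[2]) = ρ ∨ (α : ℤ_[2]) = 1 - ρ) ∧
      ∀ (σ : absoluteGaloisGroup (vbar.adicCompletion K)) (n : ℕ), IsFrobPow σ (n : ℤ) →
        ∃ s₁ s₂ : ℤ, (s₁ = 1 ∨ s₁ = -1) ∧ (s₂ = 1 ∨ s₂ = -1) ∧
          (∀ (k : ℕ) (x : (W.baseChange K).geomPrimaryTorsion 2),
            2 ^ k • x ∈ (W.baseChange K).endEigenPrimaryTorsion 2 π ρ →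
            ∀ N : ℤ, ((N : ℤ_[2]) - s₂ * ((α ^ n : ℤ_[2]ˣ) : ℤ_[2])) ∈ (Ideal.span {(2 : ℤ_[2]) ^ k} : Ideal ℤ_[2]) →
              absGaloisRestrict K (vbar.adicCompletion K) σ • x - N • x ∈ (W.baseChange K).endEigenPrimaryTorsion 2 π ρ) ∧
          (∀ (k : ℕ) (c : (W.baseChange K).geomPrimaryTorsion 2), c ∈ (W.baseChange K).endEigenPrimaryTorsion 2 π ρ →
            2 ^ k • c = 0 →
            ∀ N : ℤ, ((N : ℤ_[2]) - s₁ *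
                ((GaloisRep.cyclotomicCharacter K 2 (absGaloisRestrict K (vbar.adicCompletion K) σ) * (α⁻¹) ^ n :
                  ℤ_[2]ˣ) : ℤ_[2])) ∈ (Ideal.span {(2 : ℤ_[2]) ^ k} : Ideal ℤ_[2]) →
              absGaloisRestrict K (vbar.adicCompletion K) σ • c = N • c) := by
  obtain ⟨huni, -⟩ := endEigenPrimaryTorsion_two_inertia_smul_swap W K hj hK hθ π hrel hρ hv hvbar hne hclause
  have hρ' : (1 - ρ) * (1 - ρ) = (1 - ρ) - 2 := by linear_combination hρ
  have hclause' : ∀ τ ∈ GreenbergSelmer.inertia vbar, ∀ x ∈ (W.baseChange K).endEigenPrimaryTorsion 2 π (1 - ρ),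
      τ • x = x ∨ τ • x = -x := by
    intro τ hτ x hx
    rcases huni τ hτ with h | h
    · exact Or.inl (h x hx)
    · exact Or.inr (h x hx)
  obtain ⟨α, hα, hαρ, hdat⟩ := endEigenPrimaryTorsion_two_isOrdinaryFiltrationDatum_of_pinned W K hj hθ π hrel hρ' vbar hvbar
    (inertiaDeg_eq_one_of_ne_two K hK.1 hvbar hv hne.symm) hclause'
  refine ⟨α, hα, ?_, ?_⟩
  · rcases hαρ with h | h
    · exact Or.inr h
    · exact Or.inl (by rw [h, sub_sub_cancel])
  · simpa only [sub_sub_cancel] using hdat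

end Summit.BirchSwinnertonDyer.BirchSwinnertonDyer.Theorems.PrintCf2.CMPrimes

end
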